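import Summits.BirchSwinnertonDyer.BirchSwinnertonDyer.Theorems.EisensteinPrimesMazurTwinFamily
import HarnessLib

/-!
# Route `EisensteinPrimes`, line `mudescent`, cruxes 3/5: KUMMER SUPPORT, PARTNER TYPES and REALISER
# predicates of THEOREMS C^mix / C^oth (DEFINITIONS ONLY + unfolding / bookkeeping lemmas; helper for
# `stub_lambdaCount_offLocus`)

Seat `bsd-eis-lam-a` g12 (PROGRAMME PART 1b, ACCEL-LIST (4): ANALYTIC side of
`stub_lambdaCount_offLocus`; items stmt-BirchSwinnertonDyer-19033 / -19035; skeleton owner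
bsd-eis-ky). Filed on the planner's RULING L101 (ii) (HOME/bsd-eis STATUS l.2271): the typed objects
the paper theorems C^mix (HOME/lam-a-g11/lam-a-MEMO-11.md §3b) and C^oth (§3c) speak about, so that
`ThmCmixX2Sig / ThmCmixX1Sig / ThmCothSig` (scratch `HOME/lam-a-g12/ThmCSig.lean`) elaborate against
the route file's imports plus this module and `EisensteinPrimesMazurTwinFamily` (p589499), and the
planner can file them as `aside` items next to B′ (stmt-BirchSwinnertonDyer-24278 and -24279). Sibling of p589499
(`MazurGoodAt` / `MazurTwinFamilyAt` / `splitPrimesOutside`), whose vocabulary is reused, not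
restated. No theorem about any curve is asserted here; nothing closes; no label moves.

CONTENTS.
* §1 `IsEisensteinTypeAt p q` / `IsNonsplitTypeAt p q` — the two TYPES of a Kummer support prime
  (MEMO-10 §3b–§3c, MEMO-11 §3b): `q ≡ 1 (mod p)` [and `≡ 1 (mod 9)` at `p = 3`] — the primes
  carrying a `p`-Eisenstein maximal ideal of `𝕋(q)` (Mazur 1977 II (9.7)), SPLIT multiplicative for a
  type-A étale end ramified there —, resp. `q ≡ −1 (mod p)` [`≡ −1 (mod 9)` at `p = 3`] — NON-split
  multiplicative for such a curve (MEMO-10 §3c (iii), local analysis (i′)). At `p ≥ 5` every support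
  prime is of one of the two types; at `p = 3` the primes `≡ 2, 4, 5, 7 (mod 9)` are of neither.
* §2 `kummerSupport W p` — the Kummer support `S = {ℓ ∣ N prime, ℓ ≠ p : p ∤ v_ℓ(Δ)}` of a globally
  minimal curve: the bad primes `≠ p` at which `E[p]` is RAMIFIED (Tate: the Kummer class of `q_E`
  has valuation `v_ℓ(Δ)`); `MazurTwinFamilyAt W p q` says exactly `kummerSupport W p = {q}` on a
  squarefree conductor (lemma `MazurTwinFamilyAt.kummerSupport_eq`).
* §3 `SignCompatible W W′` — every prime dividing BOTH conductors is split for `W` iff split for `W′`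
  (THEOREM A⁺ needs one common squarefree level `M` with ONE signature `ε`; MEMO-11 §3b «sign-
  compatible»).
* §4 `OneEisensteinFamilyAt W p q₁` — the carrier of C^mix / C^oth: `MazurTwinFamilyAt` with the
  single-support clause (Ram_q) DROPPED (other support primes allowed): squarefree `N`; `q₁ ∣ N` a
  prime `≠ p` of Eisenstein type in the Kummer support; `W` the étale end (`p ∣ #E(ℚ)_tors`, no
  ramified odd line); Yoo's (Y) at `p = 3`.
* §5 `NonsplitPartnerRealiserAt W W′ p q` — a REALISER of the non-split partner `q` of `W` (C^mix):
  an étale end `W′` of squarefree conductor with Kummer support exactly `{q}`, (Y) at `p = 3`,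
  sign-compatible with `W`.
* §6 `KummerComplementRealiserAt W W′ q₁` (`p = 3`, C^oth) — a realiser of the COMPLEMENTARY Kummer
  class `c′ = c_E − a₁ b_{q₁}`: an étale end `W′` of squarefree conductor prime to `q₁`, (Y),
  sign-compatible with `W`, whose Kummer ELEMENT is proportional to `∏_{ℓ ≠ q₁} ℓ^{v_ℓ(Δ_W)}` modulo
  cubes: `v_ℓ(Δ_{W′}) ≡ ε·v_ℓ(Δ_W) (mod 3)` for one `ε ∈ {1, 2}` and every prime `ℓ ∉ {3, q₁}`
  (MEMO-11 §3c: `d(E_ét) ≡ ∏_{q∈S} q^{v_q(Δ_ét)}` mod `ℚ^{×3}` up to a global inversion).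
* Unfolding lemmas (`Iff.rfl` / `simp`) and the bookkeeping facts the Sigs and the `Λ`-sockets use:
  members of `kummerSupport` are primes `≠ p` dividing the conductor; `q₁ ∈ kummerSupport W p` on the
  family; sign-compatibility is reflexive and symmetric.

WHAT IS NOT HERE. The statements C^mix / C^oth themselves (our results on paper, PRE-grade; their
pre-registered tests are kit j295799 224/224 and j295973 305/305, HOME/bsd-eis STATUS 2026-08-28) —
the planner files them (RULING L101 (ii)); and any claim that realisers EXIST (a census fact per class).

References: [Mazur1977] II Prop. (9.7), III Cor. (8.5); [GreenbergVatsal2000] §1 (9)–(10);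
HOME/lam-a-g10/lam-a-MEMO-10.md §3b–§3c; HOME/lam-a-g11/lam-a-MEMO-11.md §3b–§3d.
-/

set_option linter.dupNamespace false
set_option autoImplicit false

noncomputable section

open scoped Classical

open WeierstrassCurve Literature.NumberTheory.EllipticCurves
  Literature.NumberTheory.EllipticCurves.Rank1Residual
  Literature.NumberTheory.EllipticCurves.GreenbergVatsal2000
  Summit.BirchSwinnertonDyer.Rank1Residual
  Literature.Barriers.BirchSwinnertonDyer
  Summit.BirchSwinnertonDyer.BirchSwinnertonDyer.Theorems.EisensteinPrimesMazurTwinFamily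

namespace Summit.BirchSwinnertonDyer.BirchSwinnertonDyer.Theorems.EisensteinPrimesKummerPartners

/-! ## §1. The two types of a Kummer support prime -/

/-- **Eisenstein type** of a support prime `q` at `p`: `q ≡ 1 (mod p)`, and `q ≡ 1 (mod 9)` when
`p = 3` — exactly the congruence clause of `MazurTwinFamilyAt` (Mazur 1977 II (9.7): `J₀(q)` has a
`p`-Eisenstein prime iff `p ∣ num((q−1)/12)`). Such a support prime is SPLIT multiplicative for a
type-A étale end ramified at `q` (MEMO-10 §3b). [cite: Mazur1977, II Prop. (9.7)] -/
def IsEisensteinTypeAt (p q : ℕ) : Prop := (q : ZMod p) = 1 ∧ (p = 3 → (q : ZMod 9) = 1)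

/-- **Non-split type** of a support prime `q` at `p`: `q ≡ −1 (mod p)`, and `q ≡ −1 (mod 9)` when
`p = 3` — the primes whose single-support Kummer class is locally trivial at `p` but which carry NO
`p`-Eisenstein prime at level `q`; NON-split multiplicative for a type-A étale end ramified at `q`
(MEMO-10 §3c (iii); Wake–Wang-Erickson's field `K_q`, `q ≡ −1`). [cite: Mazur1977, II Prop. (9.7)] -/
def IsNonsplitTypeAt (p q : ℕ) : Prop := (q : ZMod p) = -1 ∧ (p = 3 → (q : ZMod 9) = -1)

/-- Unfolding lemma for `IsEisensteinTypeAt`. [cite: Mazur1977, II Prop. (9.7)] -/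
theorem isEisensteinTypeAt_iff (p q : ℕ) :
    IsEisensteinTypeAt p q ↔ (q : ZMod p) = 1 ∧ (p = 3 → (q : ZMod 9) = 1) := Iff.rfl

/-- Unfolding lemma for `IsNonsplitTypeAt`. [cite: Mazur1977, II Prop. (9.7)] -/
theorem isNonsplitTypeAt_iff (p q : ℕ) :
    IsNonsplitTypeAt p q ↔ (q : ZMod p) = -1 ∧ (p = 3 → (q : ZMod 9) = -1) := Iff.rfl

/-- For an odd prime `p` the two types exclude each other (`1 ≠ −1` in `ZMod p` when `2 < p`).
[cite: Mazur1977, II Prop. (9.7)] -/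
theorem not_isNonsplitTypeAt_of_isEisensteinTypeAt {p q : ℕ} [hp : Fact p.Prime] (hp2 : p ≠ 2)
    (h : IsEisensteinTypeAt p q) : ¬ IsNonsplitTypeAt p q := by
  intro h'
  have h1 : (1 : ZMod p) = -1 := h.1.symm.trans h'.1
  have h2 : ((2 : ℕ) : ZMod p) = 0 := by
    rw [Nat.cast_ofNat]
    linear_combination h1
  have hdvd : p ∣ 2 := (ZMod.natCast_eq_zero_iff 2 p).1 h2
  have hle : p ≤ 2 := Nat.le_of_dvd (by norm_num) hdvd
  exact hp2 (le_antisymm hle hp.out.two_le)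

/-! ## §2. The Kummer support -/

/-- **The Kummer support of `W` at `p`:** the prime divisors `ℓ ≠ p` of the conductor with
`p ∤ v_ℓ(Δ)` — for a globally minimal curve with a rational point of order `p` and squarefree
conductor these are exactly the bad primes `≠ p` at which `E[p]` is ramified (the Kummer class of the
Tate parameter has valuation `v_ℓ(Δ)`), i.e. the support of the extension class
`c_E ∈ H¹(ℚ, 𝔽_p(ω⁻¹))` (MEMO-8 §1, MEMO-11 §3b). Junk: empty when `W.conductorNorm ℤ = 0`.
[cite: GreenbergVatsal2000, §1 (9)–(10)] -/
def kummerSupport (W : WeierstrassCurve ℚ) [W.IsElliptic] [W.IsGloballyMinimal] (p : ℕ) :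
    Finset ℕ :=
  (Nat.divisors (W.conductorNorm ℤ)).filter
    (fun ℓ ↦ ℓ.Prime ∧ ℓ ≠ p ∧ ¬ ((p : ℤ) ∣ padicValRat ℓ W.Δ))

section Support

variable {W : WeierstrassCurve ℚ} [W.IsElliptic] [W.IsGloballyMinimal] {p : ℕ}

/-- Membership in the Kummer support, unfolded. [cite: GreenbergVatsal2000, §1 (9)–(10)] -/
theorem mem_kummerSupport {ℓ : ℕ} :
    ℓ ∈ kummerSupport W p ↔
      ℓ ∣ W.conductorNorm ℤ ∧ W.conductorNorm ℤ ≠ 0 ∧ ℓ.Prime ∧ ℓ ≠ p ∧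
        ¬ ((p : ℤ) ∣ padicValRat ℓ W.Δ) := by
  simp only [kummerSupport, Finset.mem_filter, Nat.mem_divisors, and_assoc]

/-- Every support prime is a prime `≠ p` dividing the conductor at which `p ∤ v_ℓ(Δ)`.
[cite: GreenbergVatsal2000, §1 (9)–(10)] -/
theorem prime_of_mem_kummerSupport {ℓ : ℕ} (h : ℓ ∈ kummerSupport W p) :
    ℓ.Prime ∧ ℓ ≠ p ∧ ℓ ∣ W.conductorNorm ℤ ∧ ¬ ((p : ℤ) ∣ padicValRat ℓ W.Δ) := by
  obtain ⟨hd, -, hℓ, hne, hv⟩ := mem_kummerSupport.1 h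
  exact ⟨hℓ, hne, hd, hv⟩

/-- A prime `ℓ ≠ p` dividing a non-zero conductor with `p ∤ v_ℓ(Δ)` is in the Kummer support.
[cite: GreenbergVatsal2000, §1 (9)–(10)] -/
theorem mem_kummerSupport_of (hN : W.conductorNorm ℤ ≠ 0) {ℓ : ℕ} (hℓ : ℓ.Prime)
    (hd : ℓ ∣ W.conductorNorm ℤ) (hne : ℓ ≠ p) (hv : ¬ ((p : ℤ) ∣ padicValRat ℓ W.Δ)) :
    ℓ ∈ kummerSupport W p :=
  mem_kummerSupport.2 ⟨hd, hN, hℓ, hne, hv⟩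

/-- `p` itself is never in the Kummer support. [cite: GreenbergVatsal2000, §1 (9)–(10)] -/
theorem not_mem_kummerSupport_self : p ∉ kummerSupport W p := fun h ↦
  (prime_of_mem_kummerSupport h).2.1 rfl

/-- On the Mazur twin family the Kummer support is the single prime `q` (hypothesis (Ram_q) of
p589499: `E[p]` ramified at `q`, unramified at every other bad `ℓ ≠ p`).
[cite: Mazur1977, III Cor. (8.5)] -/
theorem _root_.Summit.BirchSwinnertonDyer.BirchSwinnertonDyer.Theorems.EisensteinPrimesMazurTwinFamily.MazurTwinFamilyAt.kummerSupport_eq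
    [Fact p.Prime] {q : ℕ} (h : MazurTwinFamilyAt W p q) : kummerSupport W p = {q} := by
  ext ℓ
  rw [mem_kummerSupport, Finset.mem_singleton]
  constructor
  · rintro ⟨hd, -, hℓ, hne, hv⟩
    by_contra hq
    exact hv (h.dvd_padicValRat hℓ hd hne hq)
  · rintro rfl
    have hN : W.conductorNorm ℤ ≠ 0 := fun h0 ↦ by
      have hsq := h.squarefree_conductor
      rw [h0] at hsq
      exact not_squarefree_zero hsq
    exact ⟨h.dvd_conductor, hN, h.prime, h.ne, h.not_dvd_padicValRat⟩

end Support

/-! ## §3. Sign compatibility -/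

/-- **Sign compatibility** of two curves: at every prime dividing BOTH conductors, `W` has split
multiplicative reduction iff `W′` has (for squarefree conductors: the same Atkin–Lehner sign
`ε_ℓ = −a_ℓ` at every common prime, so that both live at one common level `M` with one signature `ε`
— the setting of THEOREM A⁺, MEMO-8 / MEMO-11 §3b). [cite: GreenbergVatsal2000, §1 (9)–(10)] -/
def SignCompatible (W W' : WeierstrassCurve ℚ) [W.IsElliptic] [W'.IsElliptic] : Prop :=
  ∀ (ℓ : ℕ) (hℓ : ℓ.Prime), ℓ ∣ W.conductorNorm ℤ → ℓ ∣ W'.conductorNorm ℤ →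
    (@WeierstrassCurve.HasSplitMultiplicativeReductionAtPrime W ℓ ⟨hℓ⟩ ↔
      @WeierstrassCurve.HasSplitMultiplicativeReductionAtPrime W' ℓ ⟨hℓ⟩)

section Sign

variable {W W' : WeierstrassCurve ℚ} [W.IsElliptic] [W'.IsElliptic]

/-- Unfolding lemma for `SignCompatible`. [cite: GreenbergVatsal2000, §1 (9)–(10)] -/
theorem signCompatible_iff :
    SignCompatible W W' ↔
      ∀ (ℓ : ℕ) (hℓ : ℓ.Prime), ℓ ∣ W.conductorNorm ℤ → ℓ ∣ W'.conductorNorm ℤ →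
        (@WeierstrassCurve.HasSplitMultiplicativeReductionAtPrime W ℓ ⟨hℓ⟩ ↔
          @WeierstrassCurve.HasSplitMultiplicativeReductionAtPrime W' ℓ ⟨hℓ⟩) :=
  Iff.rfl

/-- Sign compatibility is reflexive. [cite: GreenbergVatsal2000, §1 (9)–(10)] -/
theorem signCompatible_refl (W : WeierstrassCurve ℚ) [W.IsElliptic] : SignCompatible W W :=
  fun _ _ _ _ ↦ Iff.rfl

/-- Sign compatibility is symmetric. [cite: GreenbergVatsal2000, §1 (9)–(10)] -/
theorem SignCompatible.symm (h : SignCompatible W W') : SignCompatible W' W :=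
  fun ℓ hℓ h₁ h₂ ↦ (h ℓ hℓ h₂ h₁).symm

end Sign

/-! ## §4. The one-Eisenstein-prime family (carrier of C^mix / C^oth) -/

/-- **The one-Eisenstein-prime family at `(p, q₁)`** (MEMO-11 §3b/§3c SETTING): the conductor `N` is
squarefree; `q₁` is a prime `≠ p` dividing `N`, of Eisenstein type, lying in the Kummer support
(`p ∤ v_{q₁}(Δ)`); `W` is the étale end of its class (`p ∣ #E(ℚ)_tors`, no ramified odd line); and
at `p = 3` Yoo's hypothesis (Y) holds (a prime `≡ 2 (mod 3)` divides `N`). This is `MazurTwinFamilyAt`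
with its single-support clause (Ram_q) dropped: OTHER support primes are allowed — non-split partners
(C^mix) or an arbitrary complement realised by one composite plane (C^oth).
[cite: Mazur1977, II Prop. (9.7), III Cor. (8.5)] -/
def OneEisensteinFamilyAt (W : WeierstrassCurve ℚ) [W.IsElliptic] [W.IsGloballyMinimal] (p q₁ : ℕ)
    [Fact p.Prime] : Prop :=
  Squarefree (W.conductorNorm ℤ) ∧ q₁.Prime ∧ q₁ ≠ p ∧ q₁ ∣ W.conductorNorm ℤ ∧
  IsEisensteinTypeAt p q₁ ∧
  p ∣ W.torsionOrder ∧ ¬ HasRamifiedOddLineAt W p ∧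
  ¬ ((p : ℤ) ∣ padicValRat q₁ W.Δ) ∧
  (p = 3 → ∃ ℓ : ℕ, ℓ.Prime ∧ ℓ ∣ W.conductorNorm ℤ ∧ ℓ % 3 = 2)

section OneEisenstein

variable {W : WeierstrassCurve ℚ} [W.IsElliptic] [W.IsGloballyMinimal] {p q₁ : ℕ} [Fact p.Prime]

/-- The conductor is squarefree on the family. [cite: Mazur1977, III Cor. (8.5)] -/
theorem OneEisensteinFamilyAt.squarefree_conductor (h : OneEisensteinFamilyAt W p q₁) :
    Squarefree (W.conductorNorm ℤ) := h.1

/-- The conductor is non-zero on the family. [cite: Mazur1977, III Cor. (8.5)] -/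
theorem OneEisensteinFamilyAt.conductor_ne_zero (h : OneEisensteinFamilyAt W p q₁) :
    W.conductorNorm ℤ ≠ 0 := fun h0 ↦ by
  have hsq := h.1
  rw [h0] at hsq
  exact not_squarefree_zero hsq

/-- `q₁` is a prime `≠ p` dividing the conductor, of Eisenstein type. [cite: Mazur1977, II Prop. (9.7)] -/
theorem OneEisensteinFamilyAt.prime (h : OneEisensteinFamilyAt W p q₁) :
    q₁.Prime ∧ q₁ ≠ p ∧ q₁ ∣ W.conductorNorm ℤ ∧ IsEisensteinTypeAt p q₁ :=
  ⟨h.2.1, h.2.2.1, h.2.2.2.1, h.2.2.2.2.1⟩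

/-- A member of the family is the étale end of its class: a rational point of order `p` and no
ramified odd line. [cite: Mazur1977, III Cor. (8.5)] -/
theorem OneEisensteinFamilyAt.etaleEnd (h : OneEisensteinFamilyAt W p q₁) :
    p ∣ W.torsionOrder ∧ ¬ HasRamifiedOddLineAt W p :=
  ⟨h.2.2.2.2.2.1, h.2.2.2.2.2.2.1⟩

/-- `q₁` lies in the Kummer support on the family. [cite: Mazur1977, III Cor. (8.5)] -/
theorem OneEisensteinFamilyAt.mem_kummerSupport (h : OneEisensteinFamilyAt W p q₁) :
    q₁ ∈ kummerSupport W p :=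
  mem_kummerSupport_of h.conductor_ne_zero h.2.1 h.2.2.2.1 h.2.2.1 h.2.2.2.2.2.2.2.1

/-- Yoo's hypothesis (Y) on the family at `p = 3`. [cite: Mazur1977, III Cor. (8.5)] -/
theorem OneEisensteinFamilyAt.exists_prime_mod_three (h : OneEisensteinFamilyAt W p q₁)
    (hp : p = 3) : ∃ ℓ : ℕ, ℓ.Prime ∧ ℓ ∣ W.conductorNorm ℤ ∧ ℓ % 3 = 2 :=
  h.2.2.2.2.2.2.2.2 hp

/-- The Mazur twin family is the one-Eisenstein-prime family with Kummer support `{q}`.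
[cite: Mazur1977, III Cor. (8.5)] -/
theorem _root_.Summit.BirchSwinnertonDyer.BirchSwinnertonDyer.Theorems.EisensteinPrimesMazurTwinFamily.MazurTwinFamilyAt.oneEisensteinFamilyAt
    {q : ℕ} (h : MazurTwinFamilyAt W p q) : OneEisensteinFamilyAt W p q :=
  ⟨h.squarefree_conductor, h.prime, h.ne, h.dvd_conductor, ⟨h.cast_eq_one, h.cast_eq_one_nine⟩,
    h.dvd_torsionOrder, h.not_hasRamifiedOddLineAt, h.not_dvd_padicValRat,
    h.exists_prime_mod_three⟩

end OneEisenstein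

/-! ## §5. Realisers of a non-split partner (C^mix) -/

/-- **Realiser of the non-split partner `q` of `W` at `p`** (MEMO-11 §3b «REALISER»): `W′` is an étale
end (`p ∣ #E′(ℚ)_tors`, no ramified odd line) of squarefree conductor `N′` with Kummer support EXACTLY
`{q}` (`q ∣ N′`, `p ∤ v_q(Δ′)`, `p ∣ v_ℓ(Δ′)` at every other bad `ℓ ≠ p`), satisfying (Y) at `p = 3`,
and SIGN-COMPATIBLE with `W`. Its plane realises the class `b_q` at the common level in THEOREM A⁺'s
decomposition; its existence is a census fact per `(p, q)`, not a theorem.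
[cite: Mazur1977, III Cor. (8.5)] [cite: GreenbergVatsal2000, §1 (9)–(10)] -/
def NonsplitPartnerRealiserAt (W W' : WeierstrassCurve ℚ) [W.IsElliptic] [W.IsGloballyMinimal]
    [W'.IsElliptic] [W'.IsGloballyMinimal] (p q : ℕ) [Fact p.Prime] : Prop :=
  Squarefree (W'.conductorNorm ℤ) ∧ p ∣ W'.torsionOrder ∧ ¬ HasRamifiedOddLineAt W' p ∧
  q ∣ W'.conductorNorm ℤ ∧ ¬ ((p : ℤ) ∣ padicValRat q W'.Δ) ∧
  (∀ ℓ : ℕ, ℓ.Prime → ℓ ∣ W'.conductorNorm ℤ → ℓ ≠ p → ℓ ≠ q → (p : ℤ) ∣ padicValRat ℓ W'.Δ) ∧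
  (p = 3 → ∃ ℓ : ℕ, ℓ.Prime ∧ ℓ ∣ W'.conductorNorm ℤ ∧ ℓ % 3 = 2) ∧
  SignCompatible W W'

section Partner

variable {W W' : WeierstrassCurve ℚ} [W.IsElliptic] [W.IsGloballyMinimal] [W'.IsElliptic]
  [W'.IsGloballyMinimal] {p q : ℕ} [Fact p.Prime]

/-- A partner realiser has squarefree conductor and is an étale end. [cite: Mazur1977, III Cor. (8.5)] -/
theorem NonsplitPartnerRealiserAt.etaleEnd (h : NonsplitPartnerRealiserAt W W' p q) :
    Squarefree (W'.conductorNorm ℤ) ∧ p ∣ W'.torsionOrder ∧ ¬ HasRamifiedOddLineAt W' p :=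
  ⟨h.1, h.2.1, h.2.2.1⟩

/-- A partner realiser is sign-compatible with the target. [cite: GreenbergVatsal2000, §1 (9)–(10)] -/
theorem NonsplitPartnerRealiserAt.signCompatible (h : NonsplitPartnerRealiserAt W W' p q) :
    SignCompatible W W' :=
  h.2.2.2.2.2.2.2

/-- The Kummer support of a partner realiser is exactly `{q}` (when `q` is a prime `≠ p`).
[cite: Mazur1977, III Cor. (8.5)] -/
theorem NonsplitPartnerRealiserAt.kummerSupport_eq (h : NonsplitPartnerRealiserAt W W' p q)
    (hq : q.Prime) (hqp : q ≠ p) : kummerSupport W' p = {q} := by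
  have hN : W'.conductorNorm ℤ ≠ 0 := fun h0 ↦ by
    have hsq := h.1
    rw [h0] at hsq
    exact not_squarefree_zero hsq
  ext ℓ
  rw [mem_kummerSupport, Finset.mem_singleton]
  constructor
  · rintro ⟨hd, -, hℓ, hne, hv⟩
    by_contra hne'
    exact hv (h.2.2.2.2.2.1 ℓ hℓ hd hne hne')
  · rintro rfl
    exact ⟨h.2.2.2.1, hN, hq, hqp, h.2.2.2.2.1⟩

end Partner

/-! ## §6. Realisers of the complementary Kummer class at `p = 3` (C^oth) -/

/-- **Realiser of the complementary Kummer class** of `W` relative to its Eisenstein support prime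
`q₁`, at `p = 3` (MEMO-11 §3c): `W′` is an étale end (`3 ∣ #E′(ℚ)_tors`, no ramified odd line at `3`)
of squarefree conductor `N′` PRIME TO `q₁`, satisfying (Y), sign-compatible with `W`, whose Kummer
ELEMENT is proportional to `∏_{ℓ ≠ q₁} ℓ^{v_ℓ(Δ_W)}` modulo cubes: for ONE `ε ∈ {1, 2}` (a global
inversion) and EVERY prime `ℓ ∉ {3, q₁}`, `v_ℓ(Δ_{W′}) ≡ ε · v_ℓ(Δ_W) (mod 3)` — so the support of `W′`
is `kummerSupport W 3 ∖ {q₁}` with proportional exponents (the class `c′` with `c_E = a₁ b_{q₁} + c′`;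
the Kummer element of an étale end is `∏_{q ∈ S} q^{v_q(Δ)}` mod `ℚ^{×3}`, MEMO-11 §3c).
[cite: Mazur1977, III Cor. (8.5)] [cite: GreenbergVatsal2000, §1 (9)–(10)] -/
def KummerComplementRealiserAt (W W' : WeierstrassCurve ℚ) [W.IsElliptic] [W.IsGloballyMinimal]
    [W'.IsElliptic] [W'.IsGloballyMinimal] (q₁ : ℕ) : Prop :=
  Squarefree (W'.conductorNorm ℤ) ∧ 3 ∣ W'.torsionOrder ∧
  ¬ @HasRamifiedOddLineAt W' 3 ⟨Nat.prime_three⟩ ∧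
  ¬ q₁ ∣ W'.conductorNorm ℤ ∧
  (∃ ℓ : ℕ, ℓ.Prime ∧ ℓ ∣ W'.conductorNorm ℤ ∧ ℓ % 3 = 2) ∧
  SignCompatible W W' ∧
  ∃ ε : ℕ, (ε = 1 ∨ ε = 2) ∧
    ∀ ℓ : ℕ, ℓ.Prime → ℓ ≠ 3 → ℓ ≠ q₁ →
      ((padicValRat ℓ W'.Δ : ℤ) : ZMod 3) = (ε : ZMod 3) * ((padicValRat ℓ W.Δ : ℤ) : ZMod 3)

section Complement

variable {W W' : WeierstrassCurve ℚ} [W.IsElliptic] [W.IsGloballyMinimal] [W'.IsElliptic]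
  [W'.IsGloballyMinimal] {q₁ : ℕ}

/-- A complement realiser has squarefree conductor prime to `q₁`, is an étale end at `3`, satisfies
(Y) and is sign-compatible with the target. [cite: Mazur1977, III Cor. (8.5)] -/
theorem KummerComplementRealiserAt.etaleEnd (h : KummerComplementRealiserAt W W' q₁) :
    Squarefree (W'.conductorNorm ℤ) ∧ 3 ∣ W'.torsionOrder ∧
      ¬ @HasRamifiedOddLineAt W' 3 ⟨Nat.prime_three⟩ ∧ ¬ q₁ ∣ W'.conductorNorm ℤ ∧
      SignCompatible W W' :=
  ⟨h.1, h.2.1, h.2.2.1, h.2.2.2.1, h.2.2.2.2.2.1⟩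

/-- The exponent congruence of a complement realiser: `v_ℓ(Δ′) ≡ ε v_ℓ(Δ) (mod 3)` off `{3, q₁}` for
one `ε ∈ {1, 2}`. [cite: Mazur1977, III Cor. (8.5)] -/
theorem KummerComplementRealiserAt.exists_exponent (h : KummerComplementRealiserAt W W' q₁) :
    ∃ ε : ℕ, (ε = 1 ∨ ε = 2) ∧ ∀ ℓ : ℕ, ℓ.Prime → ℓ ≠ 3 → ℓ ≠ q₁ →
      ((padicValRat ℓ W'.Δ : ℤ) : ZMod 3) = (ε : ZMod 3) * ((padicValRat ℓ W.Δ : ℤ) : ZMod 3) :=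
  h.2.2.2.2.2.2

end Complement

end Summit.BirchSwinnertonDyer.BirchSwinnertonDyer.Theorems.EisensteinPrimesKummerPartners

end
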